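import Summits.BirchSwinnertonDyer.Rank1Residual.ManinAdditive.KatoShiftThreeLaws
import Summits.BirchSwinnertonDyer.Rank1Residual.ManinConstantOne
import Summits.BirchSwinnertonDyer.BirchSwinnertonDyer.Theses.ManinLocalTwoThree
import Literature.NumberTheory.EllipticCurves.ModularFormsGamma0Genus
import Literature.NumberTheory.EllipticCurves.CuspFormLFunctionLevelConductorProofs
import Literature.NumberTheory.EllipticCurves.SkinnerUrban2014.PAdicUnitPeriodRatioProofs
import HarnessLib
import HarnessLib.Audit.Tags

/-!
# Proved edges for the prime-3 Euler-system leaves of cell `bsd-f2-manin` (E-es-18 / E-es-19 / E-es-20)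

All statements and proofs VERBATIM (up to the by-name re-basing announced in each docstring) from the planner's
Line file HOME `run/shared/lean/pub/bsd-f2-manin/es/Line-es-kato-shift-three.lean` sha16 1048ba04918db19b
(farm rc 0; refuter-1 §R34: composition kernel-checked, axioms standard). Nothing conjectural is asserted: the
leaves, the route cruxes and the named facts enter as hypotheses.

* VOCABULARY by name (`primeClass`, `shiftClass`, `shiftClassSpan`, `epsSign`, `AdmissiblePrime`,
  `IsLatticeOptimal` = the tree's `ManinAdditive.IsLatticeOptimal`-shaped clause) and the bridge
  `shiftClassGenerationThree_iff` : the inlined leaf ↔ the Line's structured statement (`Iff.rfl`).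
* PLACEMENT: `katoShiftTwistManinThree_of_maninConstantOne`, `maninPrimeToThreeOfReducible_of_maninConstantOne`
  (Manin ⟹ each law); `katoShiftTwistManinThree_of_C3`, `maninPrimeToThreeOfReducible_of_C3` (the route crux C3
  `ManinPrimeToThreeAtNine`, stmt-BirchSwinnertonDyer-22968, with its support bundle `PrintedSemistableManinFacts`,
  ⟹ each piece — refuter-1's `RefAudit41.katoShift_of_C3`).
* THE SPLIT (E-es-20) BY NAME: `maninPrimeToThreeAtNine_of_katoShift_of_reducible` :
  `KatoShiftTwistManinThree → ManinPrimeToThreeOfReducible → ManinPrimeToThreeAtNine` — C3's fact-free body is the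
  conjunction of the two leaves (cases on `W[3]` irreducible); with the two C3-edges, an `Iff` given the facts.
* THE LEVER (E-es-18 ⟸ ES-step ∧ E-es-19), with the Line's two PROVED lemmas landed here:
  `additive_of_nine_dvd_level` (9 ∣ N ⟹ additive at 3 for the newform's curve: `IsNewformOf.dvd_level_iff_dvd_
  conductorNorm`, `dvd_conductorNorm_iff_not_hasGoodReductionAtPrime`, `SkinnerUrban2014.not_sq_dvd_level_of_
  hasMultiplicativeReductionAtPrime`) and `functional_nonvanishing_gen` (the lattice-unit punchline: `Im/(Ω⁻_f/2)`
  is onto `ℤ` on `Λ_f`, so it is not `3`-divisible on a generating set of `mΛ_f`, `3 ∤ m`), and the composition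
  `katoShiftTwistManinThree_of_shiftStep` : (ES-step with a hole at `⟨3⟩`: under `3 ∣ c` every shift class over an
  admissible prime is `3`-divisible in lattice units — the Line's `stub_three_dvd_shiftClass` CONCLUSION, itself
  granted the tree fact `kato_neron_isIntegral_twistedSymbolSum_of_additive_three_polar`) →
  `ShiftClassGenerationThree` → `KatoShiftTwistManinThree`.
-/

noncomputable section

open scoped BigOperators MatrixGroups ModularForm Classical

open CongruenceSubgroup WeierstrassCurve
  Literature.NumberTheory.EllipticCurves Literature.NumberTheory.EllipticCurves.ModularForms
  Summit.BirchSwinnertonDyer.Rank1Residual.ManinConstant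
  Summit.BirchSwinnertonDyer.BirchSwinnertonDyer.Theses.ManinLocalTwoThree

namespace Summit.BirchSwinnertonDyer.Rank1Residual.ManinAdditive

/-! ### 1. Vocabulary (Line file §1, verbatim) and the by-name bridge -/

/-- The period `{0, a/ℓ}_f = {∞,a/ℓ}_f − {∞,0}_f` of the CLOSED class `c_ℓ(a) ∈ H₁(X₀(N),ℤ)` (`ℓ ∤ N`). -/
def primeClass {N : ℕ} (f : CuspForm (Gamma0 N) 2) (ℓ a : ℕ) : ℂ :=
  modularSymbol f ((a : ℚ) / ℓ) - modularSymbol f 0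

/-- The SHIFT CLASS `{a/ℓ, 3a/ℓ}_f = {0,3a/ℓ}_f − {0,a/ℓ}_f` (period of the closed class `A₃c_ℓ(a) − c_ℓ(a)`,
`A₃ = diag(3,1)`), an element of `Λ_f`. -/
def shiftClass {N : ℕ} (f : CuspForm (Gamma0 N) 2) (ℓ a : ℕ) : ℂ :=
  primeClass f ℓ (3 * a) - primeClass f ℓ a

/-- The subgroup of `ℂ` generated by the shift classes `{a/ℓ, 3a/ℓ}_f`, `ℓ ∈ S`, `0 < a < ℓ`. -/
def shiftClassSpan {N : ℕ} (f : CuspForm (Gamma0 N) 2) (S : Set ℕ) : AddSubgroup ℂ :=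
  AddSubgroup.closure {z | ∃ ℓ ∈ S, ∃ a : ℕ, 0 < a ∧ a < ℓ ∧ z = shiftClass f ℓ a}

/-- The Legendre sign demanded of an admissible auxiliary prime at a multiplicative prime `q ∥ N`
(`ε_q = −s_q`, `s_q ≡ a_q·q (mod 3)`). -/
def epsSign (W : WeierstrassCurve ℚ) [W.IsElliptic] (q : ℕ) : ℤ :=
  if ((q : ℤ) * W.LFunction q) % 3 = 1 then -1 else 1

/-- ADMISSIBLE auxiliary prime for `W` at level `N`: `ℓ ∤ N` prime, `ℓ ≡ 11 (mod 12)`, and `(q/ℓ) = ε_q(W)` at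
every `q ∥ N` (so the symmetrised imprimitivity factor is a 3-unit for every odd `χ` mod `ℓ`; and `ord_ℓ(3)` is
odd and prime to 3). -/
def AdmissiblePrime (W : WeierstrassCurve ℚ) [W.IsElliptic] (N ℓ : ℕ) : Prop :=
  ℓ.Prime ∧ ¬ ℓ ∣ N ∧ ℓ % 12 = 11 ∧
    ∀ q ∈ N.primeFactors, ¬ q ^ 2 ∣ N → jacobiSym (q : ℤ) ℓ = epsSign W q

/-- **Bridge**: the inlined leaf `ShiftClassGenerationThree` IS the Line's structured statement
`∀ W f ℓ₀, IsNewformOf W f → 9 ∣ N → irreducible → ∃ m, 3 ∤ m ∧ mΛ_f ⊆ shiftClassSpan f {ℓ | ℓ₀ ≤ ℓ ∧ admissible}`. -/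
theorem shiftClassGenerationThree_iff :
    ShiftClassGenerationThree ↔
      ∀ (W : WeierstrassCurve ℚ) [W.IsElliptic] {N : ℕ} [NeZero N] (f : CuspForm (Gamma0 N) 2) (ℓ₀ : ℕ),
        IsNewformOf W f → 3 ^ 2 ∣ N → W.HasIrreducibleModPGaloisRep 3 →
        ∃ m : ℕ, ¬ 3 ∣ m ∧ ∀ z ∈ periodLattice f,
          (m : ℂ) * z ∈ shiftClassSpan f {ℓ | ℓ₀ ≤ ℓ ∧ AdmissiblePrime W N ℓ} :=
  Iff.rfl

/-! ### 2. Placement edges: Manin ⟹ each law; the route crux C3 ⟹ each piece -/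

/-- **Manin ⟹ E-es-18.** -/
theorem katoShiftTwistManinThree_of_maninConstantOne (hMC : ManinConstantOne) :
    KatoShiftTwistManinThree := by
  intro W _ _ N _ D hD _ _ hdvd
  have h1 : |D.maninConstant| = 1 := hMC W D hD
  have h2 : (3 : ℤ) ∣ 1 := h1 ▸ (dvd_abs _ _).mpr hdvd
  omega

/-- **Manin ⟹ the reducible residual.** -/
theorem maninPrimeToThreeOfReducible_of_maninConstantOne (hMC : ManinConstantOne) :
    ManinPrimeToThreeOfReducible := by
  intro W _ _ N _ D hD _ _ hdvd
  have h1 : |D.maninConstant| = 1 := hMC W D hD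
  have h2 : (3 : ℤ) ∣ 1 := h1 ▸ (dvd_abs _ _).mpr hdvd
  omega

/-- **C3 ⟹ E-es-18** (granted the route's support bundle `PrintedSemistableManinFacts`, whose four conjuncts are
the crux's leading binders since EDIT 2): the leaf is a restriction of the crux (refuter-1 `RefAudit41.katoShift_of_C3`). -/
theorem katoShiftTwistManinThree_of_C3 (hPF : PrintedSemistableManinFacts) (h3 : ManinPrimeToThreeAtNine) :
    KatoShiftTwistManinThree := by
  obtain ⟨hM, hAU, hC, hnf⟩ := hPF
  intro W _ _ N _ D hD h9 _
  exact h3 hM hAU hC hnf W D hD h9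

/-- **C3 ⟹ the reducible residual** (same). -/
theorem maninPrimeToThreeOfReducible_of_C3 (hPF : PrintedSemistableManinFacts) (h3 : ManinPrimeToThreeAtNine) :
    ManinPrimeToThreeOfReducible := by
  obtain ⟨hM, hAU, hC, hnf⟩ := hPF
  intro W _ _ N _ D hD h9 _
  exact h3 hM hAU hC hnf W D hD h9

/-! ### 3. The split (E-es-20) BY NAME: C3 ⟸ E-es-18 ∧ residual -/

/-- **C3 ⟸ E-es-18 ∧ reducible residual** — the Line's `ManinPrimeToThreeAtNine_of_split`, concluding the route
decl `Summit.BirchSwinnertonDyer.BirchSwinnertonDyer.Theses.ManinLocalTwoThree.ManinPrimeToThreeAtNine`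
(stmt-BirchSwinnertonDyer-22968) BY NAME; the crux's four fact binders are discarded (the split needs none). -/
theorem maninPrimeToThreeAtNine_of_katoShift_of_reducible
    (hA : KatoShiftTwistManinThree) (hB : ManinPrimeToThreeOfReducible) :
    ManinPrimeToThreeAtNine := by
  intro _hMazur _hAbbesUllmo _hCesnavicius _hnf W _ _ N _ D hopt h9
  show ¬ (3 : ℤ) ∣ D.c
  by_cases hirr : W.HasIrreducibleModPGaloisRep 3
  · exact hA W D hopt h9 hirr
  · exact hB W D hopt h9 hirr

/-- **Given the printed facts, C3 ⟺ (E-es-18 ∧ residual)** — the typed partition of the crux into the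
Euler-system lens's theorem-candidate (3473 of the 4313 optimal curves with `9 ∣ N ≤ 5000`) and ONE residual
(the 840 `3`-reducible ones). -/
theorem maninPrimeToThreeAtNine_iff_katoShift_and_reducible (hPF : PrintedSemistableManinFacts) :
    ManinPrimeToThreeAtNine ↔ (KatoShiftTwistManinThree ∧ ManinPrimeToThreeOfReducible) :=
  ⟨fun h3 => ⟨katoShiftTwistManinThree_of_C3 hPF h3, maninPrimeToThreeOfReducible_of_C3 hPF h3⟩,
    fun h => maninPrimeToThreeAtNine_of_katoShift_of_reducible h.1 h.2⟩

/-! ### 4. The lever: E-es-18 ⟸ (ES-step with a hole at `⟨3⟩`) ∧ E-es-19, with the Line's two PROVED lemmas -/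

/-- `additive_of_nine_dvd_level` — LEVEL-TO-LOCAL GLUE, PROVED (Line file, es g6; UNCONDITIONAL, no modularity
binder): `3 ∣ N ⟺ 3 ∣ N_W` for the newform of `W` (`IsNewformOf.dvd_level_iff_dvd_conductorNorm`), `3 ∣ N_W ⟺ ¬
good at 3` (`dvd_conductorNorm_iff_not_hasGoodReductionAtPrime`), and multiplicative at 3 ⟹ `9 ∤ N`
(`SkinnerUrban2014.not_sq_dvd_level_of_hasMultiplicativeReductionAtPrime`, Atkin–Lehner Thm. 3). -/
theorem additive_of_nine_dvd_level :
    ∀ (W : WeierstrassCurve ℚ) [W.IsElliptic] {N : ℕ} [NeZero N] (f : CuspForm (Gamma0 N) 2),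
      IsNewformOf W f → 3 ^ 2 ∣ N →
      ¬ W.HasGoodReductionAtPrime 3 ∧ ¬ W.HasMultiplicativeReductionAtPrime 3 := by
  intro W _ N _ f hf h9
  haveI : Fact (Nat.Prime 3) := ⟨Nat.prime_three⟩
  have h3N : 3 ∣ N := dvd_trans (dvd_pow_self 3 two_ne_zero) h9
  refine ⟨fun hgood => ?_, fun hmult => ?_⟩
  · have h3c : 3 ∣ W.conductorNorm ℤ := (hf.dvd_level_iff_dvd_conductorNorm Nat.prime_three).mp h3N
    exact (W.dvd_conductorNorm_iff_not_hasGoodReductionAtPrime 3).mp h3c hgood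
  · exact SkinnerUrban2014.not_sq_dvd_level_of_hasMultiplicativeReductionAtPrime hmult hf h9

/-- `functional_nonvanishing_gen` — the LATTICE-UNIT punchline, generator-set form, PROVED (Line file, es g6;
refuter-1 §R33/§R34: sorry-free, axioms standard, `hpos` load-bearing): `im Λ_f = ℤ·(Ω⁻_f/2)` when `Ω⁻_f > 0`
(definition of `minusPeriod`), so the functional `Im/(Ω⁻_f/2)` is SURJECTIVE on `Λ_f` and cannot be divisible by 3
on every element of a set `T` whose closure contains `mΛ_f` with `3 ∤ m` (closure induction). -/
theorem functional_nonvanishing_gen {N : ℕ} [NeZero N] (f : CuspForm (Gamma0 N) 2) (T : Set ℂ) (m : ℕ)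
    (hm : ¬ 3 ∣ m) (hpos : 0 < minusPeriod f)
    (hspan : ∀ z ∈ periodLattice f, (m : ℂ) * z ∈ AddSubgroup.closure T)
    (hT : ∀ t ∈ T, ∃ n : ℤ, t.im = 3 * n * (minusPeriod f / 2)) : False := by
  classical
  have key : ∃ Ω : ℝ, 0 < Ω ∧ imagPeriods f = AddSubgroup.zmultiples (Ω / 2) := by
    by_contra h
    have : minusPeriod f = 0 := by unfold minusPeriod; rw [dif_neg h]
    linarith
  have hdef : minusPeriod f = key.choose := by unfold minusPeriod; rw [dif_pos key]
  have hΩ : imagPeriods f = AddSubgroup.zmultiples (minusPeriod f / 2) := by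
    rw [hdef]; exact key.choose_spec.2
  have hmem : minusPeriod f / 2 ∈ imagPeriods f := by
    rw [hΩ]; exact AddSubgroup.mem_zmultiples _
  obtain ⟨z, hz, hzim⟩ := AddSubgroup.mem_map.mp hmem
  have hzim' : z.im = minusPeriod f / 2 := by simpa using hzim
  have hcl : ∀ w ∈ AddSubgroup.closure T, ∃ n : ℤ, w.im = 3 * n * (minusPeriod f / 2) := by
    intro w hw
    induction hw using AddSubgroup.closure_induction with
    | mem x hx => exact hT x hx
    | zero => exact ⟨0, by simp⟩
    | add x y _ _ ihx ihy =>
      obtain ⟨a, ha⟩ := ihx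
      obtain ⟨b, hb⟩ := ihy
      exact ⟨a + b, by rw [Complex.add_im, ha, hb]; push_cast; ring⟩
    | neg x _ ih =>
      obtain ⟨a, ha⟩ := ih
      exact ⟨-a, by rw [Complex.neg_im, ha]; push_cast; ring⟩
  obtain ⟨n, hn⟩ := hcl _ (hspan z hz)
  have h1 : ((m : ℂ) * z).im = (m : ℝ) * (minusPeriod f / 2) := by
    rw [Complex.mul_im]; simp [hzim']
  have h2 : (m : ℝ) * (minusPeriod f / 2) = 3 * n * (minusPeriod f / 2) := by rw [← h1, hn]
  have hne : minusPeriod f / 2 ≠ 0 := by positivity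
  have h3 : (m : ℝ) = 3 * n := mul_right_cancel₀ hne h2
  have h4 : (m : ℤ) = 3 * n := by exact_mod_cast h3
  exact hm (Int.natCast_dvd_natCast.mp ⟨n, by simpa using h4⟩)

/-- **THE LEVER: E-es-18 ⟸ (ES-step with a hole at `⟨3⟩`) ∧ E-es-19** — the Line's `katoShiftTwistManinThree_of`
with its two provable binders DISCHARGED by `additive_of_nine_dvd_level` and `functional_nonvanishing_gen`.  The
remaining hypothesis `hE` is the CONCLUSION of the Line's registered stub `stub_three_dvd_shiftClass` (size L,
itself granted the tree's named fact `kato_neron_isIntegral_twistedSymbolSum_of_additive_three_polar`: at a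
lattice-optimal datum with `9 ∣ N`, `W` additive at 3, `W[3]` irreducible and `3 ∣ c`, every shift class over an
admissible prime has imaginary part in `3ℤ·(Ω⁻_f/2)`), and `hG` is the leaf `ShiftClassGenerationThree` (by the
bridge `shiftClassGenerationThree_iff`). -/
theorem katoShiftTwistManinThree_of_shiftStep
    (hE : ∀ (W : WeierstrassCurve ℚ) [W.IsElliptic] [W.IsGloballyMinimal] {N : ℕ} [NeZero N]
      (D : ModularParametrizationData W N),
      (∀ z ∈ D.L.lattice, ∃ w ∈ periodLattice D.f, z = D.c * w) → 3 ^ 2 ∣ N →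
      ¬ W.HasGoodReductionAtPrime 3 → ¬ W.HasMultiplicativeReductionAtPrime 3 →
      W.HasIrreducibleModPGaloisRep 3 → (3 : ℤ) ∣ D.c →
      ∀ ℓ : ℕ, AdmissiblePrime W N ℓ → ∀ a : ℕ, 0 < a → a < ℓ →
        ∃ n : ℤ, (shiftClass D.f ℓ a).im = 3 * n * (minusPeriod D.f / 2))
    (hG : ShiftClassGenerationThree) :
    KatoShiftTwistManinThree := by
  intro W _ _ N _ D hopt h9 hirr h3
  obtain ⟨hg, hm⟩ := additive_of_nine_dvd_level W D.f D.isNewformOf h9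
  obtain ⟨m, hm3, hspan⟩ := (shiftClassGenerationThree_iff.mp hG) W D.f 0 D.isNewformOf h9 hirr
  have hpos : 0 < minusPeriod D.f :=
    IsNewform0.minusPeriod_pos_holds D.isNewformOf.1 D.isNewformOf.coeffField_eq_bot
  refine functional_nonvanishing_gen D.f
    {z | ∃ ℓ ∈ {ℓ | 0 ≤ ℓ ∧ AdmissiblePrime W N ℓ}, ∃ a : ℕ, 0 < a ∧ a < ℓ ∧ z = shiftClass D.f ℓ a}
    m hm3 hpos hspan ?_
  rintro t ⟨ℓ, hℓ, a, ha1, ha2, rfl⟩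
  exact hE W D hopt h9 hg hm hirr h3 ℓ hℓ.2 a ha1 ha2

/-- **E-es-18 ⟹ the Kosters–Pannekoek-restricted form of line `kato-tame-three` (E-es-14 shape)**: any extra
curve-side hypothesis `KP` only restricts the locus (the Line's `katoTame_of_katoShift`). -/
theorem katoShiftTwistManinThree.restrict (h : KatoShiftTwistManinThree)
    (KP : WeierstrassCurve ℚ → Prop) :
    ∀ (W : WeierstrassCurve ℚ) [W.IsElliptic] [W.IsGloballyMinimal] {N : ℕ} [NeZero N]
      (D : ModularParametrizationData W N),
      (∀ z ∈ D.L.lattice, ∃ w ∈ periodLattice D.f, z = D.c * w) → 3 ^ 2 ∣ N →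
      W.HasIrreducibleModPGaloisRep 3 → KP W → ¬ (3 : ℤ) ∣ D.c :=
  fun W _ _ _ _ D hopt h9 hirr _ => h W D hopt h9 hirr

end Summit.BirchSwinnertonDyer.Rank1Residual.ManinAdditive

end
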